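import Mathlib
import Summits.Ventures.HodgeRepro.Tier4.Line4.L1ClassV3
import Summits.Ventures.HodgeRepro.Tier4.Line4.ProdFnIntegrable
import Summits.Ventures.HodgeRepro.Tier4.Line4.ArchProdCoeff
import Summits.Ventures.HodgeRepro.Tier4.Line4.ArchProdInfOnly

/-!
# Tier4/Line4/ArchWitnessAssembly — `IsArchCoeffD` FOR THE PRODUCT WITNESSES BY NAME: display (7a) of LINE L4 closed
MODULO its displayed prints (the `G_∞`-integrability of the `w₀`-factor, the non-vanishing of the archimedean factor, the
operator Schur clauses), each a hypothesis of THIS lemma and of nothing else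

Blind re-derivation cell `pub-hodge-repro`, Tier 4 (README §9–§10), seat t4-L1-p5 (prover, gen 5; C-L4-ARCHPROD S15149 /
S15216; plan-4 g5's S15217 «the by-name assembly of `IsArchCoeffD` for the witness is the v0.38 candidate»; crit-1 g9's
STANDING RULE S15224 (3): the prints are hypotheses of the LEMMA, never binders of (7a), the wall or `target_L4v3` — this
module is SUPPORT, «(7a) closed modulo the prints»).  Target tree path
`lean/Summits/Ventures/HodgeRepro/Tier4/Line4/ArchWitnessAssembly.lean`.  On plan-4's `L1ClassV3` (`IsArchCoeffD`,
`D3CoeffData'`, p700401), L4-p1's `ProdFnIntegrable` (p701176: `integrable_prodFn_of_isFinFactor`) and the seat's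
`ArchProdCoeff` / `ArchProdInfOnly`; no printed input consumed — the prints are DISPLAYED as hypotheses.

THE FIELDS of `IsArchCoeffD W S R q g g' w₀ eP eM eP' eM' γ₀ νinf νinf' finf` for `finf = archWitness` (the branch
`eP′ w₀ = eM′ w₀ + 3`; `archWitness'` for `eM′ w₀ = eP′ w₀ + 3`), under the hypotheses `w₀` real CM with the `U(1,1)` signs
`0 < (a 1)_{w₀}`, `(−a 3)_{w₀} < 0`, and every `w′ ≠ w₀` real CM and DEFINITE:
* `cont` — `continuous_archWitness` (kernel);
* `infOnly` — `archWitness_ofInfPart` (kernel, on L4-p1's `locEntry'_ofInfPart`);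
* `equiv` — `cj_archWitness_inv_mul` (kernel, every place, every displayed weight);
* `decay` — `decay_archWitness` (kernel; `HasDecay3` by `unfold`);
* `integrable` — `integrable_prodFn_of_isFinFactor` on a Haar measure `μinf` of `G_∞` from the ONE print
  **`hinf : Integrable (fun y : infinitePart W => archWitness y) μinf`** (Harish-Chandra: the matrix coefficients of the
  weight-3 discrete series are in `L¹`, `D_k ⊂ L¹ ⟺ k ≥ 3`; the twist and the definite factors are bounded);
* `arch_ne` — the print **`harch : archFactor W R archWitness γ₀ νinf νinf' ≠ 0`** (the `w₀`-Fourier coefficient of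
  `a′ ↦ α′(γ₀ a′)^{−3}` on the compact torus times the definite-place twisted integrals, non-zero for the line's `γ₀`);
* `pseudo`, `pseudo'` — the prints **`hpseudo`, `hpseudo'`** (operator Schur for the integrable discrete series
  `D₃ ⊗ det^{−m}` on the closed irreducible constituents).

WHAT IS PROVED: `a_one_ne_zero_of_pos` / `a_three_ne_zero_of_neg` (the sign clauses give `a 1 ≠ 0`, `a 3 ≠ 0`);
**`isArchCoeffD_archWitness_of_fields`** (the structure from its kernel fields + the four print hypotheses in their field
shapes), **`isArchCoeffD_archWitness`** (the same with `integrable` derived from `hinf`), **`d3CoeffData'_archWitness`**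
(`D3CoeffData' … = ∃ finf, IsArchCoeffD … finf` with the witness `archWitness`), and the three `archWitness'` twins.
The consumer (display (7a), v0.38) picks the branch by `_he'`, supplies the line's `γ₀`, and discharges the prints.
Nothing here says anything about the status of the Hodge conjecture for CM abelian varieties, which is NOT proved
(HC_CM is NOT proved by anyone in this repository).
-/

set_option autoImplicit false

noncomputable section

namespace Summit.Ventures.HodgeRepro.Tier4.Line4

open Summit.Ventures.HodgeRepro.Tier4.Common Summit.Ventures.HodgeRepro.Tier4.Line1 NumberField Matrix MeasureTheory

open scoped ComplexConjugate

section Signs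

variable {k : Type} [Field k] [NumberField k] (a : Fin 4 → k) (w : InfinitePlace k)

/-- `0 < (a 1)_w.re ⇒ a 1 ≠ 0`. -/
theorem a_one_ne_zero_of_pos (ha1 : 0 < (adToC w (algebraMap k (Ad k) (a 1))).re) : a 1 ≠ 0 := by
  intro h
  rw [h, map_zero, map_zero, Complex.zero_re] at ha1
  exact lt_irrefl _ ha1

/-- `(−1 · a 3)_w.re < 0 ⇒ a 3 ≠ 0`. -/
theorem a_three_ne_zero_of_neg (ha3 : (adToC w (algebraMap k (Ad k) (-1 * a 3))).re < 0) : a 3 ≠ 0 := by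
  intro h
  rw [h, mul_zero, map_zero, map_zero, Complex.zero_re] at ha3
  exact lt_irrefl _ ha3

end Signs

section Assembly

variable {k : Type} [Field k] [NumberField k] (q : QuadData k) (a : Fin 4 → k)
  (g g' : Matrix (Fin 4) (Fin 4) k) (hgg' : g * g' = 1) (hg'g : g' * g = 1)
  (hgΩ : g * (PlaneData.mixedRow q (a 0) (a 2)).Ω = (PlaneData.mixedRow q (a 0) (a 2)).Ω * g)
  (lam : k) (hlam : lam ≠ 0)
  (hiso : g * (PlaneData.mixedRow q (a 1) (a 3)).B * gᵀ = lam • (PlaneData.mixedRow q (a 0) (a 2)).B)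
  [MeasurableSpace (GA ((PlaneData.mixedRow q (a 0) (a 2)).withTransportedTorus g g' hgg' hg'g hgΩ))]
  [BorelSpace (GA ((PlaneData.mixedRow q (a 0) (a 2)).withTransportedTorus g g' hgg' hg'g hgΩ))]
  (S : RTF.Setting (GA ((PlaneData.mixedRow q (a 0) (a 2)).withTransportedTorus g g' hgg' hg'g hgΩ)))
  (R : RTFData ((PlaneData.mixedRow q (a 0) (a 2)).withTransportedTorus g g' hgg' hg'g hgΩ))
  (w₀ : InfinitePlace k) (eP eM eP' eM' : InfinitePlace k → ℤ)
  (γ₀ : GA ((PlaneData.mixedRow q (a 0) (a 2)).withTransportedTorus g g' hgg' hg'g hgΩ))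
  (νinf : Measure (torusInf ((PlaneData.mixedRow q (a 0) (a 2)).withTransportedTorus g g' hgg' hg'g hgΩ)))
  (νinf' : Measure (torusInf' ((PlaneData.mixedRow q (a 0) (a 2)).withTransportedTorus g g' hgg' hg'g hgΩ)))

include hlam in
omit [BorelSpace (GA ((PlaneData.mixedRow q (a 0) (a 2)).withTransportedTorus g g' hgg' hg'g hgΩ))] in
/-- **`IsArchCoeffD` for `archWitness` from its kernel fields and the four displayed prints** (branch
`eP′ w₀ = eM′ w₀ + 3`; `w₀` real CM with the `U(1,1)` signs, every `w′ ≠ w₀` real CM and definite). -/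
theorem isArchCoeffD_archWitness_of_fields (hw₀ : w₀.IsReal) (hcm₀ : IsCMAt q w₀)
    (ha1 : 0 < (adToC w₀ (algebraMap k (Ad k) (a 1))).re) (ha3 : (adToC w₀ (algebraMap k (Ad k) (-1 * a 3))).re < 0)
    (hdef : ∀ w' : InfinitePlace k, w' ≠ w₀ → w'.IsReal ∧ IsCMAt q w' ∧
      0 < (adToC w' (algebraMap k (Ad k) (a 1))).re * (adToC w' (algebraMap k (Ad k) (-1 * a 3))).re)
    (he : eP' w₀ = eM' w₀ + 3)
    (harch : L1Class.archFactor ((PlaneData.mixedRow q (a 0) (a 2)).withTransportedTorus g g' hgg' hg'g hgΩ) R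
      (archWitness q a g g' hgg' hg'g hgΩ lam hiso w₀ eP' eM') γ₀ νinf νinf' ≠ 0)
    (hint : ∀ ffin : GA ((PlaneData.mixedRow q (a 0) (a 2)).withTransportedTorus g g' hgg' hg'g hgΩ) → ℂ,
      L1Class.IsFinFactor ((PlaneData.mixedRow q (a 0) (a 2)).withTransportedTorus g g' hgg' hg'g hgΩ) ffin →
      Integrable (L1Class.prodFn ((PlaneData.mixedRow q (a 0) (a 2)).withTransportedTorus g g' hgg' hg'g hgΩ)
        (archWitness q a g g' hgg' hg'g hgΩ lam hiso w₀ eP' eM') ffin) S.μ)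
    (hpseudo : ∀ ffin : GA ((PlaneData.mixedRow q (a 0) (a 2)).withTransportedTorus g g' hgg' hg'g hgΩ) → ℂ,
      L1Class.IsFinFactor ((PlaneData.mixedRow q (a 0) (a 2)).withTransportedTorus g g' hgg' hg'g hgΩ) ffin →
      IsPseudoCoeffAt ((PlaneData.mixedRow q (a 0) (a 2)).withTransportedTorus g g' hgg' hg'g hgΩ) S q w₀ eP eM
        (RTF.cj (L1Class.prodFn ((PlaneData.mixedRow q (a 0) (a 2)).withTransportedTorus g g' hgg' hg'g hgΩ)
          (archWitness q a g g' hgg' hg'g hgΩ lam hiso w₀ eP' eM') ffin)))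
    (hpseudo' : ∀ ffin : GA ((PlaneData.mixedRow q (a 0) (a 2)).withTransportedTorus g g' hgg' hg'g hgΩ) → ℂ,
      L1Class.IsFinFactor ((PlaneData.mixedRow q (a 0) (a 2)).withTransportedTorus g g' hgg' hg'g hgΩ) ffin →
      IsPseudoCoeffAt' ((PlaneData.mixedRow q (a 0) (a 2)).withTransportedTorus g g' hgg' hg'g hgΩ) S q g g' w₀ eP' eM'
        (RTF.cj (L1Class.prodFn ((PlaneData.mixedRow q (a 0) (a 2)).withTransportedTorus g g' hgg' hg'g hgΩ)
          (archWitness q a g g' hgg' hg'g hgΩ lam hiso w₀ eP' eM') ffin))) :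
    L1Class.IsArchCoeffD ((PlaneData.mixedRow q (a 0) (a 2)).withTransportedTorus g g' hgg' hg'g hgΩ) S R q g g' w₀
      eP eM eP' eM' γ₀ νinf νinf' (archWitness q a g g' hgg' hg'g hgΩ lam hiso w₀ eP' eM') where
  cont := continuous_archWitness q a g g' hgg' hg'g hgΩ lam hiso w₀ eP' eM' hw₀ hcm₀ ha1 ha3
  infOnly := archWitness_ofInfPart q a g g' hgg' hg'g hgΩ lam hiso w₀ eP' eM'
  arch_ne := harch
  equiv := cj_archWitness_inv_mul q a g g' hgg' hg'g hgΩ lam hlam hiso w₀ eP' eM' hw₀ hcm₀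
    (a_one_ne_zero_of_pos a w₀ ha1) (a_three_ne_zero_of_neg a w₀ ha3) (fun w' hw' => ⟨(hdef w' hw').1, (hdef w' hw').2.1⟩) he
  integrable := hint
  pseudo := hpseudo
  pseudo' := hpseudo'
  decay := decay_archWitness q a g g' hgg' hg'g hgΩ lam hlam hiso w₀ eP' eM' hw₀ hcm₀ ha1 ha3 hdef

include hlam in
omit [BorelSpace (GA ((PlaneData.mixedRow q (a 0) (a 2)).withTransportedTorus g g' hgg' hg'g hgΩ))] in
/-- **`IsArchCoeffD` for `archWitness'`** (branch `eM′ w₀ = eP′ w₀ + 3`). -/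
theorem isArchCoeffD_archWitness'_of_fields (hw₀ : w₀.IsReal) (hcm₀ : IsCMAt q w₀)
    (ha1 : 0 < (adToC w₀ (algebraMap k (Ad k) (a 1))).re) (ha3 : (adToC w₀ (algebraMap k (Ad k) (-1 * a 3))).re < 0)
    (hdef : ∀ w' : InfinitePlace k, w' ≠ w₀ → w'.IsReal ∧ IsCMAt q w' ∧
      0 < (adToC w' (algebraMap k (Ad k) (a 1))).re * (adToC w' (algebraMap k (Ad k) (-1 * a 3))).re)
    (he : eM' w₀ = eP' w₀ + 3)
    (harch : L1Class.archFactor ((PlaneData.mixedRow q (a 0) (a 2)).withTransportedTorus g g' hgg' hg'g hgΩ) R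
      (archWitness' q a g g' hgg' hg'g hgΩ lam hiso w₀ eP' eM') γ₀ νinf νinf' ≠ 0)
    (hint : ∀ ffin : GA ((PlaneData.mixedRow q (a 0) (a 2)).withTransportedTorus g g' hgg' hg'g hgΩ) → ℂ,
      L1Class.IsFinFactor ((PlaneData.mixedRow q (a 0) (a 2)).withTransportedTorus g g' hgg' hg'g hgΩ) ffin →
      Integrable (L1Class.prodFn ((PlaneData.mixedRow q (a 0) (a 2)).withTransportedTorus g g' hgg' hg'g hgΩ)
        (archWitness' q a g g' hgg' hg'g hgΩ lam hiso w₀ eP' eM') ffin) S.μ)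
    (hpseudo : ∀ ffin : GA ((PlaneData.mixedRow q (a 0) (a 2)).withTransportedTorus g g' hgg' hg'g hgΩ) → ℂ,
      L1Class.IsFinFactor ((PlaneData.mixedRow q (a 0) (a 2)).withTransportedTorus g g' hgg' hg'g hgΩ) ffin →
      IsPseudoCoeffAt ((PlaneData.mixedRow q (a 0) (a 2)).withTransportedTorus g g' hgg' hg'g hgΩ) S q w₀ eP eM
        (RTF.cj (L1Class.prodFn ((PlaneData.mixedRow q (a 0) (a 2)).withTransportedTorus g g' hgg' hg'g hgΩ)
          (archWitness' q a g g' hgg' hg'g hgΩ lam hiso w₀ eP' eM') ffin)))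
    (hpseudo' : ∀ ffin : GA ((PlaneData.mixedRow q (a 0) (a 2)).withTransportedTorus g g' hgg' hg'g hgΩ) → ℂ,
      L1Class.IsFinFactor ((PlaneData.mixedRow q (a 0) (a 2)).withTransportedTorus g g' hgg' hg'g hgΩ) ffin →
      IsPseudoCoeffAt' ((PlaneData.mixedRow q (a 0) (a 2)).withTransportedTorus g g' hgg' hg'g hgΩ) S q g g' w₀ eP' eM'
        (RTF.cj (L1Class.prodFn ((PlaneData.mixedRow q (a 0) (a 2)).withTransportedTorus g g' hgg' hg'g hgΩ)
          (archWitness' q a g g' hgg' hg'g hgΩ lam hiso w₀ eP' eM') ffin))) :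
    L1Class.IsArchCoeffD ((PlaneData.mixedRow q (a 0) (a 2)).withTransportedTorus g g' hgg' hg'g hgΩ) S R q g g' w₀
      eP eM eP' eM' γ₀ νinf νinf' (archWitness' q a g g' hgg' hg'g hgΩ lam hiso w₀ eP' eM') where
  cont := continuous_archWitness' q a g g' hgg' hg'g hgΩ lam hiso w₀ eP' eM' hw₀ hcm₀ ha1 ha3
  infOnly := archWitness'_ofInfPart q a g g' hgg' hg'g hgΩ lam hiso w₀ eP' eM'
  arch_ne := harch
  equiv := cj_archWitness'_inv_mul q a g g' hgg' hg'g hgΩ lam hlam hiso w₀ eP' eM' hw₀ hcm₀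
    (a_one_ne_zero_of_pos a w₀ ha1) (a_three_ne_zero_of_neg a w₀ ha3) (fun w' hw' => ⟨(hdef w' hw').1, (hdef w' hw').2.1⟩) he
  integrable := hint
  pseudo := hpseudo
  pseudo' := hpseudo'
  decay := decay_archWitness' q a g g' hgg' hg'g hgΩ lam hlam hiso w₀ eP' eM' hw₀ hcm₀ ha1 ha3 hdef

include hlam in
/-- **`IsArchCoeffD` for `archWitness` with `integrable` from the ONE `G_∞`-print** `hinf` (Harish-Chandra's `L¹`
discrete series, folded through L4-p1's `integrable_prodFn_of_isFinFactor` on a Haar measure `μinf` of `G_∞`). -/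
theorem isArchCoeffD_archWitness [S.μ.IsHaarMeasure]
    (μinf : Measure (infinitePart ((PlaneData.mixedRow q (a 0) (a 2)).withTransportedTorus g g' hgg' hg'g hgΩ)))
    [μinf.IsHaarMeasure]
    (hw₀ : w₀.IsReal) (hcm₀ : IsCMAt q w₀)
    (ha1 : 0 < (adToC w₀ (algebraMap k (Ad k) (a 1))).re) (ha3 : (adToC w₀ (algebraMap k (Ad k) (-1 * a 3))).re < 0)
    (hdef : ∀ w' : InfinitePlace k, w' ≠ w₀ → w'.IsReal ∧ IsCMAt q w' ∧
      0 < (adToC w' (algebraMap k (Ad k) (a 1))).re * (adToC w' (algebraMap k (Ad k) (-1 * a 3))).re)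
    (he : eP' w₀ = eM' w₀ + 3)
    (hinf : Integrable (fun y : infinitePart ((PlaneData.mixedRow q (a 0) (a 2)).withTransportedTorus g g' hgg' hg'g hgΩ) =>
      archWitness q a g g' hgg' hg'g hgΩ lam hiso w₀ eP' eM' y) μinf)
    (harch : L1Class.archFactor ((PlaneData.mixedRow q (a 0) (a 2)).withTransportedTorus g g' hgg' hg'g hgΩ) R
      (archWitness q a g g' hgg' hg'g hgΩ lam hiso w₀ eP' eM') γ₀ νinf νinf' ≠ 0)
    (hpseudo : ∀ ffin : GA ((PlaneData.mixedRow q (a 0) (a 2)).withTransportedTorus g g' hgg' hg'g hgΩ) → ℂ,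
      L1Class.IsFinFactor ((PlaneData.mixedRow q (a 0) (a 2)).withTransportedTorus g g' hgg' hg'g hgΩ) ffin →
      IsPseudoCoeffAt ((PlaneData.mixedRow q (a 0) (a 2)).withTransportedTorus g g' hgg' hg'g hgΩ) S q w₀ eP eM
        (RTF.cj (L1Class.prodFn ((PlaneData.mixedRow q (a 0) (a 2)).withTransportedTorus g g' hgg' hg'g hgΩ)
          (archWitness q a g g' hgg' hg'g hgΩ lam hiso w₀ eP' eM') ffin)))
    (hpseudo' : ∀ ffin : GA ((PlaneData.mixedRow q (a 0) (a 2)).withTransportedTorus g g' hgg' hg'g hgΩ) → ℂ,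
      L1Class.IsFinFactor ((PlaneData.mixedRow q (a 0) (a 2)).withTransportedTorus g g' hgg' hg'g hgΩ) ffin →
      IsPseudoCoeffAt' ((PlaneData.mixedRow q (a 0) (a 2)).withTransportedTorus g g' hgg' hg'g hgΩ) S q g g' w₀ eP' eM'
        (RTF.cj (L1Class.prodFn ((PlaneData.mixedRow q (a 0) (a 2)).withTransportedTorus g g' hgg' hg'g hgΩ)
          (archWitness q a g g' hgg' hg'g hgΩ lam hiso w₀ eP' eM') ffin))) :
    L1Class.IsArchCoeffD ((PlaneData.mixedRow q (a 0) (a 2)).withTransportedTorus g g' hgg' hg'g hgΩ) S R q g g' w₀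
      eP eM eP' eM' γ₀ νinf νinf' (archWitness q a g g' hgg' hg'g hgΩ lam hiso w₀ eP' eM') :=
  isArchCoeffD_archWitness_of_fields q a g g' hgg' hg'g hgΩ lam hlam hiso S R w₀ eP eM eP' eM' γ₀ νinf νinf' hw₀ hcm₀
    ha1 ha3 hdef he harch
    (fun _ hffin => integrable_prodFn_of_isFinFactor _ S.μ μinf hinf hffin) hpseudo hpseudo'

include hlam in
/-- **`IsArchCoeffD` for `archWitness'` with `integrable` from the ONE `G_∞`-print** `hinf`. -/
theorem isArchCoeffD_archWitness' [S.μ.IsHaarMeasure]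
    (μinf : Measure (infinitePart ((PlaneData.mixedRow q (a 0) (a 2)).withTransportedTorus g g' hgg' hg'g hgΩ)))
    [μinf.IsHaarMeasure]
    (hw₀ : w₀.IsReal) (hcm₀ : IsCMAt q w₀)
    (ha1 : 0 < (adToC w₀ (algebraMap k (Ad k) (a 1))).re) (ha3 : (adToC w₀ (algebraMap k (Ad k) (-1 * a 3))).re < 0)
    (hdef : ∀ w' : InfinitePlace k, w' ≠ w₀ → w'.IsReal ∧ IsCMAt q w' ∧
      0 < (adToC w' (algebraMap k (Ad k) (a 1))).re * (adToC w' (algebraMap k (Ad k) (-1 * a 3))).re)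
    (he : eM' w₀ = eP' w₀ + 3)
    (hinf : Integrable (fun y : infinitePart ((PlaneData.mixedRow q (a 0) (a 2)).withTransportedTorus g g' hgg' hg'g hgΩ) =>
      archWitness' q a g g' hgg' hg'g hgΩ lam hiso w₀ eP' eM' y) μinf)
    (harch : L1Class.archFactor ((PlaneData.mixedRow q (a 0) (a 2)).withTransportedTorus g g' hgg' hg'g hgΩ) R
      (archWitness' q a g g' hgg' hg'g hgΩ lam hiso w₀ eP' eM') γ₀ νinf νinf' ≠ 0)
    (hpseudo : ∀ ffin : GA ((PlaneData.mixedRow q (a 0) (a 2)).withTransportedTorus g g' hgg' hg'g hgΩ) → ℂ,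
      L1Class.IsFinFactor ((PlaneData.mixedRow q (a 0) (a 2)).withTransportedTorus g g' hgg' hg'g hgΩ) ffin →
      IsPseudoCoeffAt ((PlaneData.mixedRow q (a 0) (a 2)).withTransportedTorus g g' hgg' hg'g hgΩ) S q w₀ eP eM
        (RTF.cj (L1Class.prodFn ((PlaneData.mixedRow q (a 0) (a 2)).withTransportedTorus g g' hgg' hg'g hgΩ)
          (archWitness' q a g g' hgg' hg'g hgΩ lam hiso w₀ eP' eM') ffin)))
    (hpseudo' : ∀ ffin : GA ((PlaneData.mixedRow q (a 0) (a 2)).withTransportedTorus g g' hgg' hg'g hgΩ) → ℂ,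
      L1Class.IsFinFactor ((PlaneData.mixedRow q (a 0) (a 2)).withTransportedTorus g g' hgg' hg'g hgΩ) ffin →
      IsPseudoCoeffAt' ((PlaneData.mixedRow q (a 0) (a 2)).withTransportedTorus g g' hgg' hg'g hgΩ) S q g g' w₀ eP' eM'
        (RTF.cj (L1Class.prodFn ((PlaneData.mixedRow q (a 0) (a 2)).withTransportedTorus g g' hgg' hg'g hgΩ)
          (archWitness' q a g g' hgg' hg'g hgΩ lam hiso w₀ eP' eM') ffin))) :
    L1Class.IsArchCoeffD ((PlaneData.mixedRow q (a 0) (a 2)).withTransportedTorus g g' hgg' hg'g hgΩ) S R q g g' w₀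
      eP eM eP' eM' γ₀ νinf νinf' (archWitness' q a g g' hgg' hg'g hgΩ lam hiso w₀ eP' eM') :=
  isArchCoeffD_archWitness'_of_fields q a g g' hgg' hg'g hgΩ lam hlam hiso S R w₀ eP eM eP' eM' γ₀ νinf νinf' hw₀ hcm₀
    ha1 ha3 hdef he harch
    (fun _ hffin => integrable_prodFn_of_isFinFactor _ S.μ μinf hinf hffin) hpseudo hpseudo'

include hlam in
/-- **`D3CoeffData'` with the witness `archWitness`** (branch `eP′ w₀ = eM′ w₀ + 3`), modulo the four displayed prints. -/
theorem d3CoeffData'_archWitness [S.μ.IsHaarMeasure]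
    (μinf : Measure (infinitePart ((PlaneData.mixedRow q (a 0) (a 2)).withTransportedTorus g g' hgg' hg'g hgΩ)))
    [μinf.IsHaarMeasure]
    (hw₀ : w₀.IsReal) (hcm₀ : IsCMAt q w₀)
    (ha1 : 0 < (adToC w₀ (algebraMap k (Ad k) (a 1))).re) (ha3 : (adToC w₀ (algebraMap k (Ad k) (-1 * a 3))).re < 0)
    (hdef : ∀ w' : InfinitePlace k, w' ≠ w₀ → w'.IsReal ∧ IsCMAt q w' ∧
      0 < (adToC w' (algebraMap k (Ad k) (a 1))).re * (adToC w' (algebraMap k (Ad k) (-1 * a 3))).re)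
    (he : eP' w₀ = eM' w₀ + 3)
    (hinf : Integrable (fun y : infinitePart ((PlaneData.mixedRow q (a 0) (a 2)).withTransportedTorus g g' hgg' hg'g hgΩ) =>
      archWitness q a g g' hgg' hg'g hgΩ lam hiso w₀ eP' eM' y) μinf)
    (harch : L1Class.archFactor ((PlaneData.mixedRow q (a 0) (a 2)).withTransportedTorus g g' hgg' hg'g hgΩ) R
      (archWitness q a g g' hgg' hg'g hgΩ lam hiso w₀ eP' eM') γ₀ νinf νinf' ≠ 0)
    (hpseudo : ∀ ffin : GA ((PlaneData.mixedRow q (a 0) (a 2)).withTransportedTorus g g' hgg' hg'g hgΩ) → ℂ,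
      L1Class.IsFinFactor ((PlaneData.mixedRow q (a 0) (a 2)).withTransportedTorus g g' hgg' hg'g hgΩ) ffin →
      IsPseudoCoeffAt ((PlaneData.mixedRow q (a 0) (a 2)).withTransportedTorus g g' hgg' hg'g hgΩ) S q w₀ eP eM
        (RTF.cj (L1Class.prodFn ((PlaneData.mixedRow q (a 0) (a 2)).withTransportedTorus g g' hgg' hg'g hgΩ)
          (archWitness q a g g' hgg' hg'g hgΩ lam hiso w₀ eP' eM') ffin)))
    (hpseudo' : ∀ ffin : GA ((PlaneData.mixedRow q (a 0) (a 2)).withTransportedTorus g g' hgg' hg'g hgΩ) → ℂ,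
      L1Class.IsFinFactor ((PlaneData.mixedRow q (a 0) (a 2)).withTransportedTorus g g' hgg' hg'g hgΩ) ffin →
      IsPseudoCoeffAt' ((PlaneData.mixedRow q (a 0) (a 2)).withTransportedTorus g g' hgg' hg'g hgΩ) S q g g' w₀ eP' eM'
        (RTF.cj (L1Class.prodFn ((PlaneData.mixedRow q (a 0) (a 2)).withTransportedTorus g g' hgg' hg'g hgΩ)
          (archWitness q a g g' hgg' hg'g hgΩ lam hiso w₀ eP' eM') ffin))) :
    L1Class.D3CoeffData' ((PlaneData.mixedRow q (a 0) (a 2)).withTransportedTorus g g' hgg' hg'g hgΩ) S R q g g' w₀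
      eP eM eP' eM' γ₀ νinf νinf' :=
  ⟨_, isArchCoeffD_archWitness q a g g' hgg' hg'g hgΩ lam hlam hiso S R w₀ eP eM eP' eM' γ₀ νinf νinf' μinf hw₀ hcm₀
    ha1 ha3 hdef he hinf harch hpseudo hpseudo'⟩

include hlam in
/-- **`D3CoeffData'` with the witness `archWitness'`** (branch `eM′ w₀ = eP′ w₀ + 3`), modulo the four displayed prints. -/
theorem d3CoeffData'_archWitness' [S.μ.IsHaarMeasure]
    (μinf : Measure (infinitePart ((PlaneData.mixedRow q (a 0) (a 2)).withTransportedTorus g g' hgg' hg'g hgΩ)))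
    [μinf.IsHaarMeasure]
    (hw₀ : w₀.IsReal) (hcm₀ : IsCMAt q w₀)
    (ha1 : 0 < (adToC w₀ (algebraMap k (Ad k) (a 1))).re) (ha3 : (adToC w₀ (algebraMap k (Ad k) (-1 * a 3))).re < 0)
    (hdef : ∀ w' : InfinitePlace k, w' ≠ w₀ → w'.IsReal ∧ IsCMAt q w' ∧
      0 < (adToC w' (algebraMap k (Ad k) (a 1))).re * (adToC w' (algebraMap k (Ad k) (-1 * a 3))).re)
    (he : eM' w₀ = eP' w₀ + 3)
    (hinf : Integrable (fun y : infinitePart ((PlaneData.mixedRow q (a 0) (a 2)).withTransportedTorus g g' hgg' hg'g hgΩ) =>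
      archWitness' q a g g' hgg' hg'g hgΩ lam hiso w₀ eP' eM' y) μinf)
    (harch : L1Class.archFactor ((PlaneData.mixedRow q (a 0) (a 2)).withTransportedTorus g g' hgg' hg'g hgΩ) R
      (archWitness' q a g g' hgg' hg'g hgΩ lam hiso w₀ eP' eM') γ₀ νinf νinf' ≠ 0)
    (hpseudo : ∀ ffin : GA ((PlaneData.mixedRow q (a 0) (a 2)).withTransportedTorus g g' hgg' hg'g hgΩ) → ℂ,
      L1Class.IsFinFactor ((PlaneData.mixedRow q (a 0) (a 2)).withTransportedTorus g g' hgg' hg'g hgΩ) ffin →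
      IsPseudoCoeffAt ((PlaneData.mixedRow q (a 0) (a 2)).withTransportedTorus g g' hgg' hg'g hgΩ) S q w₀ eP eM
        (RTF.cj (L1Class.prodFn ((PlaneData.mixedRow q (a 0) (a 2)).withTransportedTorus g g' hgg' hg'g hgΩ)
          (archWitness' q a g g' hgg' hg'g hgΩ lam hiso w₀ eP' eM') ffin)))
    (hpseudo' : ∀ ffin : GA ((PlaneData.mixedRow q (a 0) (a 2)).withTransportedTorus g g' hgg' hg'g hgΩ) → ℂ,
      L1Class.IsFinFactor ((PlaneData.mixedRow q (a 0) (a 2)).withTransportedTorus g g' hgg' hg'g hgΩ) ffin →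
      IsPseudoCoeffAt' ((PlaneData.mixedRow q (a 0) (a 2)).withTransportedTorus g g' hgg' hg'g hgΩ) S q g g' w₀ eP' eM'
        (RTF.cj (L1Class.prodFn ((PlaneData.mixedRow q (a 0) (a 2)).withTransportedTorus g g' hgg' hg'g hgΩ)
          (archWitness' q a g g' hgg' hg'g hgΩ lam hiso w₀ eP' eM') ffin))) :
    L1Class.D3CoeffData' ((PlaneData.mixedRow q (a 0) (a 2)).withTransportedTorus g g' hgg' hg'g hgΩ) S R q g g' w₀
      eP eM eP' eM' γ₀ νinf νinf' :=
  ⟨_, isArchCoeffD_archWitness' q a g g' hgg' hg'g hgΩ lam hlam hiso S R w₀ eP eM eP' eM' γ₀ νinf νinf' μinf hw₀ hcm₀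
    ha1 ha3 hdef he hinf harch hpseudo hpseudo'⟩

end Assembly

end Summit.Ventures.HodgeRepro.Tier4.Line4

end
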